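import Summits.Ventures.CertifiedManyBodySolver.Observables.StripeOrderKernels
import HarnessLib

/-!
# Wiener's lemma for Bragg weights: box means of `e^{-iQ·r} C(r)` converge to `μ(Q + 2πℤᵈ)`

HONEST FRAMING: first certified bounds; not a superconductivity verdict; every number certified or labelled float.

Speedrun `mbsolver`, seat sr-mbsolver-m3-4 (stripe observables), gen 8.  Pure harmonic analysis; 0 compute.

This file turns the WORDS "the Bragg weight `μ(Q + 2πℤᵈ)` of a measure representing the correlation
function `C` is the squared long-range-order parameter at wavevector `Q`" (module docstrings of
`Observables/StripeOrderKernels.lean`, `Observables/StripeOrderKernelCeiling.lean`) into a theorem about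
`C` alone: for every finite measure `μ` on `ℝᵈ` with `∫ exp (i r·ξ) dμ(ξ) = C r` (`r ∈ ℤᵈ`; the conclusion of
Herglotz's theorem `Literature.Analysis.FunctionSpaces.IsPositiveDefinite.exists_measure_integral_exp_eq`) and
every `Q ∈ ℝᵈ`, the box CESÀRO MEANS

  `boxMean C Q M = M^{-d} Σ_{j ∈ {0,…,M-1}ᵈ} e^{-i j·Q} C(j)`

converge, as `M → ∞`, to `μ.real (braggSet Q) = μ(Q + 2πℤᵈ) = braggWeight μ ![Q]` (`tendsto_boxMean`,
real parts `tendsto_boxMean_re_braggWeight`), and so do the STRUCTURE-FACTOR (double-sum, Fejér) MEANS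

  `boxPairMean C Q M = M^{-2d} Σ_{x,y ∈ {0,…,M-1}ᵈ} e^{-i(x−y)·Q} C(x − y)`

(`tendsto_boxPairMean`, `tendsto_boxPairMean_re_braggWeight`) — for `C(r) = ω(A₀†A_r)` of a lattice-translation-
invariant state this is the structure factor per site `S_Λ(Q)/|Λ|` of the box `Λ`, i.e. the Bragg weight IS
the thermodynamic limit of `S_Λ(Q)/|Λ|` (the squared order parameter at `Q`).  In particular the Bragg weight
does not depend on the choice of representing measure (`braggWeight_single_eq_of_representing`), and it
vanishes iff `S_Λ(Q) = o(|Λ|)` (absence of long-range order at `Q`).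

Proof (Wiener): `Σ_j e^{-ij·Q} C(j) = ∫ Σ_j e^{ij·(ξ-Q)} dμ = M^d ∫ Π_i D_M(ξ_i − Q_i) dμ` and
`Σ_{x,y} e^{-i(x−y)·Q} C(x−y) = M^{2d} ∫ |Π_i D_M(ξ_i − Q_i)|² dμ` with the normalised one-sided Dirichlet means
`D_M(θ) = M⁻¹ Σ_{m<M} e^{imθ}`; `|D_M| ≤ 1`, `D_M(θ) = 1` if `e^{iθ} = 1` and `D_M(θ) → 0` otherwise (geometric
sum `|Σ_{m<M} z^m| ≤ 2/|z − 1|`); dominated convergence.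
-/

noncomputable section

namespace Summit.Ventures.CertifiedManyBodySolver.Observables

open MeasureTheory Complex Filter Topology
open scoped Real BigOperators

/-! ### One-dimensional Dirichlet means -/

/-- The normalised one-sided Dirichlet mean `D_M(θ) = M⁻¹ Σ_{m<M} e^{imθ}` (`= 0` for `M = 0`). -/
def dirichletMean (M : ℕ) (θ : ℝ) : ℂ :=
  (∑ m ∈ Finset.range M, exp ((((m : ℝ) * θ : ℝ) : ℂ) * I)) / (M : ℂ)

/-- `D_M` is continuous in `θ`. -/
theorem continuous_dirichletMean (M : ℕ) : Continuous (dirichletMean M) := by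
  unfold dirichletMean
  fun_prop

/-- The Dirichlet sum is a geometric sum in `z = e^{iθ}`. -/
theorem dirichletSum_eq_geom_sum (M : ℕ) (θ : ℝ) :
    ∑ m ∈ Finset.range M, exp ((((m : ℝ) * θ : ℝ) : ℂ) * I)
      = ∑ m ∈ Finset.range M, exp ((θ : ℂ) * I) ^ m := by
  refine Finset.sum_congr rfl fun m _ => ?_
  rw [← Complex.exp_nat_mul]
  congr 1
  push_cast
  ring

/-- `|D_M(θ)| ≤ 1`. -/
theorem norm_dirichletMean_le_one (M : ℕ) (θ : ℝ) : ‖dirichletMean M θ‖ ≤ 1 := by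
  unfold dirichletMean
  rcases Nat.eq_zero_or_pos M with hM | hM
  · subst hM
    simp
  have hM' : (0 : ℝ) < M := by exact_mod_cast hM
  rw [norm_div, Complex.norm_natCast, div_le_one hM']
  calc ‖∑ m ∈ Finset.range M, exp ((((m : ℝ) * θ : ℝ) : ℂ) * I)‖
      ≤ ∑ m ∈ Finset.range M, ‖exp ((((m : ℝ) * θ : ℝ) : ℂ) * I)‖ := norm_sum_le _ _
    _ = M := by
      rw [Finset.sum_congr rfl fun m _ => Complex.norm_exp_ofReal_mul_I _]
      simp

/-- On `e^{iθ} = 1` (i.e. `θ ∈ 2πℤ`) the Dirichlet mean is `1` (for `M ≠ 0`). -/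
theorem dirichletMean_eq_one {θ : ℝ} (h : exp ((θ : ℂ) * I) = 1) {M : ℕ} (hM : M ≠ 0) :
    dirichletMean M θ = 1 := by
  unfold dirichletMean
  rw [dirichletSum_eq_geom_sum, h]
  simp only [one_pow, Finset.sum_const, Finset.card_range, nsmul_eq_mul, mul_one]
  have : (M : ℂ) ≠ 0 := by exact_mod_cast hM
  exact div_self this

/-- Off `2πℤ` the Dirichlet sums are uniformly bounded: `|Σ_{m<M} e^{imθ}| ≤ 2/|e^{iθ} − 1|`. -/
theorem norm_dirichletSum_le {θ : ℝ} (h : exp ((θ : ℂ) * I) ≠ 1) (M : ℕ) :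
    ‖∑ m ∈ Finset.range M, exp ((((m : ℝ) * θ : ℝ) : ℂ) * I)‖ ≤ 2 / ‖exp ((θ : ℂ) * I) - 1‖ := by
  rw [dirichletSum_eq_geom_sum]
  set z := exp ((θ : ℂ) * I) with hz
  have hz1 : ‖z‖ = 1 := by rw [hz]; exact Complex.norm_exp_ofReal_mul_I θ
  have hpos : 0 < ‖z - 1‖ := norm_pos_iff.mpr (sub_ne_zero.mpr h)
  rw [le_div_iff₀ hpos]
  calc ‖∑ m ∈ Finset.range M, z ^ m‖ * ‖z - 1‖
      = ‖(∑ m ∈ Finset.range M, z ^ m) * (z - 1)‖ := (norm_mul _ _).symm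
    _ = ‖z ^ M - 1‖ := by rw [geom_sum_mul]
    _ ≤ ‖z ^ M‖ + ‖(1 : ℂ)‖ := norm_sub_le _ _
    _ = 2 := by rw [norm_pow, hz1, one_pow, norm_one]; norm_num

/-- Off `2πℤ` the Dirichlet means tend to `0`. -/
theorem tendsto_dirichletMean_zero {θ : ℝ} (h : exp ((θ : ℂ) * I) ≠ 1) :
    Tendsto (fun M => dirichletMean M θ) atTop (𝓝 0) := by
  set B := 2 / ‖exp ((θ : ℂ) * I) - 1‖ with hB
  refine squeeze_zero_norm (a := fun M : ℕ => B / M) (fun M => ?_)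
    (tendsto_const_div_atTop_nhds_zero_nat B)
  unfold dirichletMean
  rw [norm_div, Complex.norm_natCast]
  rcases Nat.eq_zero_or_pos M with hM | hM
  · subst hM
    simp
  · exact div_le_div_of_nonneg_right (norm_dirichletSum_le h M) (by exact_mod_cast hM.le)

/-- `e^{iθ} = 1 ↔ θ ∈ 2πℤ` for real `θ`. -/
theorem exp_ofReal_mul_I_eq_one_iff (θ : ℝ) : exp ((θ : ℂ) * I) = 1 ↔ ∃ n : ℤ, θ = 2 * π * n := by
  rw [Complex.exp_eq_one_iff]
  constructor
  · rintro ⟨n, hn⟩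
    refine ⟨n, ?_⟩
    have h2 : (θ : ℂ) * I = ((2 * π * n : ℝ) : ℂ) * I := hn.trans (by push_cast; ring)
    exact_mod_cast mul_right_cancel₀ Complex.I_ne_zero h2
  · rintro ⟨n, hn⟩
    exact ⟨n, by rw [hn]; push_cast; ring⟩

/-! ### Box means and the product kernel -/

section Wiener

variable {d : ℕ}

/-- The box CESÀRO MEAN `M^{-d} Σ_{j ∈ {0,…,M-1}ᵈ} e^{-i j·Q} C(j)` of the phase-weighted lattice function
(`= 0` for `M = 0`). -/
def boxMean (C : (Fin d → ℤ) → ℂ) (Q : Fin d → ℝ) (M : ℕ) : ℂ :=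
  (∑ j ∈ Fintype.piFinset (fun _ : Fin d => Finset.range M),
      exp (-((((∑ i, (j i : ℝ) * Q i : ℝ)) : ℂ) * I)) * C (fun i => (j i : ℤ))) / (M : ℂ) ^ d

/-- The product Dirichlet kernel `Π_i D_M(ξ_i − Q_i)`. -/
def boxKernel (Q : Fin d → ℝ) (M : ℕ) (ξ : EuclideanSpace ℝ (Fin d)) : ℂ :=
  ∏ i, dirichletMean M (ξ i - Q i)

/-- The product kernel is continuous in `ξ`. -/
theorem continuous_boxKernel (Q : Fin d → ℝ) (M : ℕ) : Continuous (boxKernel Q M) := by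
  unfold boxKernel
  exact continuous_finsetProd _ fun i _ => (continuous_dirichletMean M).comp (by fun_prop)

/-- `|Π_i D_M(ξ_i − Q_i)| ≤ 1`. -/
theorem norm_boxKernel_le_one (Q : Fin d → ℝ) (M : ℕ) (ξ : EuclideanSpace ℝ (Fin d)) :
    ‖boxKernel Q M ξ‖ ≤ 1 := by
  unfold boxKernel
  rw [norm_prod]
  exact Finset.prod_le_one (fun i _ => norm_nonneg _) fun i _ => norm_dirichletMean_le_one _ _

/-- The product kernel is the normalised box sum of plane waves:
`Π_i D_M(ξ_i − Q_i) = M^{-d} Σ_{j ∈ box} e^{i j·(ξ − Q)}`. -/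
theorem boxKernel_eq (Q : Fin d → ℝ) (M : ℕ) (ξ : EuclideanSpace ℝ (Fin d)) :
    boxKernel Q M ξ = (∑ j ∈ Fintype.piFinset (fun _ : Fin d => Finset.range M),
      exp ((((∑ i, (j i : ℝ) * (ξ i - Q i) : ℝ)) : ℂ) * I)) / (M : ℂ) ^ d := by
  unfold boxKernel dirichletMean
  rw [Finset.prod_div_distrib, Finset.prod_const, Finset.card_univ, Fintype.card_fin,
    Finset.prod_univ_sum]
  congr 1
  refine Finset.sum_congr rfl fun j _ => ?_
  rw [← Complex.exp_sum]
  congr 1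
  push_cast
  rw [Finset.sum_mul]

/-- Pointwise limit of the product kernel: the indicator of `Q + 2πℤᵈ`. -/
theorem tendsto_boxKernel (Q : Fin d → ℝ) (ξ : EuclideanSpace ℝ (Fin d)) :
    Tendsto (fun M => boxKernel Q M ξ) atTop
      (𝓝 ((braggSet Q).indicator (fun _ => (1 : ℂ)) ξ)) := by
  by_cases hξ : ξ ∈ braggSet Q
  · rw [Set.indicator_of_mem hξ]
    obtain ⟨m, hm⟩ := hξ
    have h1 : ∀ i, exp (((ξ i - Q i : ℝ) : ℂ) * I) = 1 := fun i =>
      (exp_ofReal_mul_I_eq_one_iff _).mpr ⟨m i, by rw [hm i]; ring⟩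
    refine (tendsto_const_nhds (x := (1 : ℂ))).congr' ?_
    filter_upwards [eventually_ge_atTop 1] with M hM
    unfold boxKernel
    exact (Finset.prod_eq_one fun i _ => dirichletMean_eq_one (h1 i) (by omega)).symm
  · rw [Set.indicator_of_notMem hξ]
    have hex : ∃ i, exp (((ξ i - Q i : ℝ) : ℂ) * I) ≠ 1 := by
      by_contra hall
      push Not at hall
      apply hξ
      choose n hn using fun i => (exp_ofReal_mul_I_eq_one_iff _).mp (hall i)
      exact ⟨n, fun i => by linarith [hn i]⟩
    obtain ⟨i₀, hi₀⟩ := hex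
    have hD : Tendsto (fun M => ‖dirichletMean M (ξ i₀ - Q i₀)‖) atTop (𝓝 0) := by
      simpa using (tendsto_dirichletMean_zero hi₀).norm
    refine squeeze_zero_norm (fun M => ?_) hD
    unfold boxKernel
    rw [norm_prod, ← Finset.mul_prod_erase Finset.univ _ (Finset.mem_univ i₀)]
    exact mul_le_of_le_one_right (norm_nonneg _)
      (Finset.prod_le_one (fun i _ => norm_nonneg _) fun i _ => norm_dirichletMean_le_one _ _)

variable {C : (Fin d → ℤ) → ℂ} (μ : Measure (EuclideanSpace ℝ (Fin d))) [IsFiniteMeasure μ]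

/-- A unimodular exponential of a continuous real phase is integrable against a finite measure. -/
theorem integrable_exp_ofReal_mul_I {φ : EuclideanSpace ℝ (Fin d) → ℝ} (hφ : Continuous φ) :
    Integrable (fun ξ => exp ((φ ξ : ℂ) * I)) μ := by
  refine Integrable.mono' (integrable_const (1 : ℝ)) ?_ (ae_of_all _ fun ξ => ?_)
  · exact (Complex.continuous_exp.comp
      ((Complex.continuous_ofReal.comp hφ).mul continuous_const)).aestronglyMeasurable
  · rw [Complex.norm_exp_ofReal_mul_I]

omit [IsFiniteMeasure μ] in
/-- Shifted moments: `∫ e^{i r·(ξ − Q)} dμ = e^{-i r·Q} C(r)` for `r ∈ ℤᵈ`. -/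
theorem integral_exp_shift
    (hμ : ∀ r : Fin d → ℤ, ∫ ξ, exp ((∑ i, (r i : ℝ) * ξ i : ℝ) * I) ∂μ = C r)
    (Q : Fin d → ℝ) (r : Fin d → ℤ) :
    ∫ ξ, exp ((((∑ i, (r i : ℝ) * (ξ i - Q i) : ℝ)) : ℂ) * I) ∂μ
      = exp (-((((∑ i, (r i : ℝ) * Q i : ℝ)) : ℂ) * I)) * C r := by
  rw [← hμ r, ← integral_const_mul]
  refine integral_congr_ae (ae_of_all _ fun ξ => ?_)
  dsimp only
  rw [← Complex.exp_add]
  congr 1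
  push_cast
  simp only [mul_sub, Finset.sum_sub_distrib]
  ring

omit [IsFiniteMeasure μ] in
/-- One box term: `∫ e^{i j·(ξ − Q)} dμ = e^{-i j·Q} C(j)` for `j ∈ ℕᵈ`. -/
theorem integral_exp_box_term
    (hμ : ∀ r : Fin d → ℤ, ∫ ξ, exp ((∑ i, (r i : ℝ) * ξ i : ℝ) * I) ∂μ = C r)
    (Q : Fin d → ℝ) (j : Fin d → ℕ) :
    ∫ ξ, exp ((((∑ i, (j i : ℝ) * (ξ i - Q i) : ℝ)) : ℂ) * I) ∂μ
      = exp (-((((∑ i, (j i : ℝ) * Q i : ℝ)) : ℂ) * I)) * C (fun i => (j i : ℤ)) := by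
  have h := integral_exp_shift μ hμ Q (fun i => (j i : ℤ))
  simp only [Int.cast_natCast] at h
  exact h

/-- The box mean is the `μ`-integral of the product kernel. -/
theorem boxMean_eq_integral_boxKernel
    (hμ : ∀ r : Fin d → ℤ, ∫ ξ, exp ((∑ i, (r i : ℝ) * ξ i : ℝ) * I) ∂μ = C r)
    (Q : Fin d → ℝ) (M : ℕ) :
    boxMean C Q M = ∫ ξ, boxKernel Q M ξ ∂μ := by
  have hK : boxKernel Q M = fun ξ => (∑ j ∈ Fintype.piFinset (fun _ : Fin d => Finset.range M),
      exp ((((∑ i, (j i : ℝ) * (ξ i - Q i) : ℝ)) : ℂ) * I)) / (M : ℂ) ^ d :=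
    funext (boxKernel_eq Q M)
  rw [hK, integral_div, integral_finsetSum _ (fun j _ => ?_)]
  · unfold boxMean
    congr 1
    exact Finset.sum_congr rfl fun j _ => (integral_exp_box_term μ hμ Q j).symm
  · exact integrable_exp_ofReal_mul_I μ (by fun_prop)

/-- **Wiener's lemma (box Cesàro means).**  For a finite measure `μ` on `ℝᵈ` representing `C : ℤᵈ → ℂ`
and any `Q ∈ ℝᵈ`, `M^{-d} Σ_{j ∈ {0,…,M-1}ᵈ} e^{-i j·Q} C(j) → μ(Q + 2πℤᵈ)` as `M → ∞`. -/
theorem tendsto_boxMean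
    (hμ : ∀ r : Fin d → ℤ, ∫ ξ, exp ((∑ i, (r i : ℝ) * ξ i : ℝ) * I) ∂μ = C r)
    (Q : Fin d → ℝ) :
    Tendsto (fun M => boxMean C Q M) atTop (𝓝 ((μ.real (braggSet Q) : ℝ) : ℂ)) := by
  have hF : (fun M => boxMean C Q M) = fun M => ∫ ξ, boxKernel Q M ξ ∂μ :=
    funext fun M => boxMean_eq_integral_boxKernel μ hμ Q M
  have hlim : ((μ.real (braggSet Q) : ℝ) : ℂ) = ∫ ξ, (braggSet Q).indicator (fun _ => (1 : ℂ)) ξ ∂μ := by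
    rw [integral_indicator_const _ (measurableSet_braggSet Q)]
    simp
  rw [hF, hlim]
  exact tendsto_integral_of_dominated_convergence (fun _ => (1 : ℝ))
    (fun M => (continuous_boxKernel Q M).aestronglyMeasurable) (integrable_const _)
    (fun M => ae_of_all _ fun ξ => norm_boxKernel_le_one Q M ξ)
    (ae_of_all _ fun ξ => tendsto_boxKernel Q ξ)

/-- A single-wavevector Bragg weight is the mass of its Bragg set. -/
theorem braggWeight_single (μ : Measure (EuclideanSpace ℝ (Fin d))) (Q : Fin d → ℝ) :
    braggWeight μ ![Q] = μ.real (braggSet Q) := by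
  unfold braggWeight Measure.real
  congr 2
  ext ξ
  simp [Set.mem_iUnion]

/-- **The Bragg weight is the Cesàro limit of the phase-weighted correlations** — in particular it is the
same for every representing measure: `Re (M^{-d} Σ_{j ∈ box_M} e^{-i j·Q} C(j)) → braggWeight μ ![Q]`. -/
theorem tendsto_boxMean_re_braggWeight
    (hμ : ∀ r : Fin d → ℤ, ∫ ξ, exp ((∑ i, (r i : ℝ) * ξ i : ℝ) * I) ∂μ = C r)
    (Q : Fin d → ℝ) :
    Tendsto (fun M => (boxMean C Q M).re) atTop (𝓝 (braggWeight μ ![Q])) := by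
  rw [braggWeight_single]
  have h := (Complex.continuous_re.tendsto _).comp (tendsto_boxMean μ hμ Q)
  rwa [Complex.ofReal_re] at h

/-- Uniqueness corollary: two finite measures representing the same `C` give the same Bragg weights. -/
theorem braggWeight_single_eq_of_representing
    (hμ : ∀ r : Fin d → ℤ, ∫ ξ, exp ((∑ i, (r i : ℝ) * ξ i : ℝ) * I) ∂μ = C r)
    (ν : Measure (EuclideanSpace ℝ (Fin d))) [IsFiniteMeasure ν]
    (hν : ∀ r : Fin d → ℤ, ∫ ξ, exp ((∑ i, (r i : ℝ) * ξ i : ℝ) * I) ∂ν = C r)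
    (Q : Fin d → ℝ) :
    braggWeight μ ![Q] = braggWeight ν ![Q] :=
  tendsto_nhds_unique (tendsto_boxMean_re_braggWeight μ hμ Q) (tendsto_boxMean_re_braggWeight ν hν Q)

/-! ### Structure-factor (double-sum) means: `|Λ|^{-2} Σ_{x,y∈Λ} e^{-i(x−y)·Q} C(x − y)` (the structure
factor PER SITE `S_Λ(Q)/|Λ|` of the box `Λ = {0,…,M-1}ᵈ`) converges to the same Bragg weight (Fejér means). -/

/-- `Σ_{x,y ∈ box} e^{i(x−y)·θ} = |Σ_{x ∈ box} e^{ix·θ}|²`. -/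
theorem boxPairSum_eq_norm_sq (M : ℕ) (θ : Fin d → ℝ) :
    ∑ x ∈ Fintype.piFinset (fun _ : Fin d => Finset.range M),
      ∑ y ∈ Fintype.piFinset (fun _ : Fin d => Finset.range M),
        exp ((((∑ i, ((x i : ℝ) - y i) * θ i : ℝ)) : ℂ) * I)
      = (((‖∑ x ∈ Fintype.piFinset (fun _ : Fin d => Finset.range M),
            exp ((((∑ i, (x i : ℝ) * θ i : ℝ)) : ℂ) * I)‖ ^ 2 : ℝ)) : ℂ) := by
  have key : ∀ z : ℂ, (((‖z‖ ^ 2 : ℝ)) : ℂ) = z * (starRingEnd ℂ) z := fun z => by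
    rw [Complex.mul_conj']
    push_cast
    ring
  rw [key, map_sum, Finset.sum_mul_sum]
  refine Finset.sum_congr rfl fun x _ => Finset.sum_congr rfl fun y _ => ?_
  rw [← Complex.exp_conj, ← Complex.exp_add]
  congr 1
  simp only [map_mul, Complex.conj_ofReal, Complex.conj_I]
  push_cast
  simp only [sub_mul, Finset.sum_sub_distrib]
  ring

/-- The box STRUCTURE-FACTOR MEAN `M^{-2d} Σ_{x,y ∈ {0,…,M-1}ᵈ} e^{-i(x−y)·Q} C(x − y)`; for `C(r) = ω(A₀† A_r)`
of a translation-invariant state this is `S_Λ(Q)/|Λ|`, the structure factor per site of the box `Λ`. -/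
def boxPairMean (C : (Fin d → ℤ) → ℂ) (Q : Fin d → ℝ) (M : ℕ) : ℂ :=
  (∑ x ∈ Fintype.piFinset (fun _ : Fin d => Finset.range M),
    ∑ y ∈ Fintype.piFinset (fun _ : Fin d => Finset.range M),
      exp (-((((∑ i, ((x i : ℝ) - y i) * Q i : ℝ)) : ℂ) * I)) * C (fun i => (x i : ℤ) - y i))
    / (M : ℂ) ^ (2 * d)

/-- Pointwise: `|Π_i D_M(ξ_i − Q_i)|² = M^{-2d} Σ_{x,y ∈ box} e^{i(x−y)·(ξ−Q)}`. -/
theorem norm_boxKernel_sq_eq (Q : Fin d → ℝ) (M : ℕ) (ξ : EuclideanSpace ℝ (Fin d)) :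
    (((‖boxKernel Q M ξ‖ ^ 2 : ℝ)) : ℂ)
      = (∑ x ∈ Fintype.piFinset (fun _ : Fin d => Finset.range M),
          ∑ y ∈ Fintype.piFinset (fun _ : Fin d => Finset.range M),
            exp ((((∑ i, ((x i : ℝ) - y i) * (ξ i - Q i) : ℝ)) : ℂ) * I)) / (M : ℂ) ^ (2 * d) := by
  rw [boxPairSum_eq_norm_sq M (fun i => ξ i - Q i), boxKernel_eq, norm_div, norm_pow,
    Complex.norm_natCast, div_pow, ← pow_mul']
  push_cast
  rfl

/-- The structure-factor mean is the `μ`-integral of `|Π_i D_M(ξ_i − Q_i)|²`. -/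
theorem boxPairMean_eq_integral
    (hμ : ∀ r : Fin d → ℤ, ∫ ξ, exp ((∑ i, (r i : ℝ) * ξ i : ℝ) * I) ∂μ = C r)
    (Q : Fin d → ℝ) (M : ℕ) :
    boxPairMean C Q M = ∫ ξ, (((‖boxKernel Q M ξ‖ ^ 2 : ℝ)) : ℂ) ∂μ := by
  have hK : (fun ξ : EuclideanSpace ℝ (Fin d) => (((‖boxKernel Q M ξ‖ ^ 2 : ℝ)) : ℂ))
      = fun ξ => (∑ x ∈ Fintype.piFinset (fun _ : Fin d => Finset.range M),
          ∑ y ∈ Fintype.piFinset (fun _ : Fin d => Finset.range M),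
            exp ((((∑ i, ((x i : ℝ) - y i) * (ξ i - Q i) : ℝ)) : ℂ) * I)) / (M : ℂ) ^ (2 * d) :=
    funext (norm_boxKernel_sq_eq Q M)
  have hint : ∀ x y : Fin d → ℕ, Integrable (fun ξ : EuclideanSpace ℝ (Fin d) =>
      exp ((((∑ i, ((x i : ℝ) - y i) * (ξ i - Q i) : ℝ)) : ℂ) * I)) μ :=
    fun x y => integrable_exp_ofReal_mul_I μ (by fun_prop)
  rw [hK, integral_div, integral_finsetSum _ (fun x _ => integrable_finsetSum _ fun y _ => hint x y)]
  unfold boxPairMean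
  congr 1
  refine Finset.sum_congr rfl fun x _ => ?_
  rw [integral_finsetSum _ (fun y _ => hint x y)]
  refine Finset.sum_congr rfl fun y _ => ?_
  have h := integral_exp_shift μ hμ Q (fun i => (x i : ℤ) - y i)
  simp only [Int.cast_sub, Int.cast_natCast] at h
  exact h.symm

/-- **Wiener's lemma (structure-factor form).**  `M^{-2d} Σ_{x,y ∈ box_M} e^{-i(x−y)·Q} C(x − y) → μ(Q + 2πℤᵈ)`:
the structure factor per site converges to the Bragg weight. -/
theorem tendsto_boxPairMean
    (hμ : ∀ r : Fin d → ℤ, ∫ ξ, exp ((∑ i, (r i : ℝ) * ξ i : ℝ) * I) ∂μ = C r)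
    (Q : Fin d → ℝ) :
    Tendsto (fun M => boxPairMean C Q M) atTop (𝓝 ((μ.real (braggSet Q) : ℝ) : ℂ)) := by
  have hF : (fun M => boxPairMean C Q M) = fun M => ∫ ξ, (((‖boxKernel Q M ξ‖ ^ 2 : ℝ)) : ℂ) ∂μ :=
    funext fun M => boxPairMean_eq_integral μ hμ Q M
  have hlim : ((μ.real (braggSet Q) : ℝ) : ℂ) = ∫ ξ, (braggSet Q).indicator (fun _ => (1 : ℂ)) ξ ∂μ := by
    rw [integral_indicator_const _ (measurableSet_braggSet Q)]
    simp
  have hsq : ∀ ξ : EuclideanSpace ℝ (Fin d), (braggSet Q).indicator (fun _ => (1 : ℂ)) ξ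
      = (((‖(braggSet Q).indicator (fun _ => (1 : ℂ)) ξ‖ ^ 2 : ℝ)) : ℂ) := by
    intro ξ
    by_cases hξ : ξ ∈ braggSet Q
    · simp [Set.indicator_of_mem hξ]
    · simp [Set.indicator_of_notMem hξ]
  rw [hF, hlim]
  refine tendsto_integral_of_dominated_convergence (fun _ => (1 : ℝ))
    (fun M => ?_) (integrable_const _) (fun M => ae_of_all _ fun ξ => ?_)
    (ae_of_all _ fun ξ => ?_)
  · exact (Complex.continuous_ofReal.comp ((continuous_boxKernel Q M).norm.pow 2)).aestronglyMeasurable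
  · rw [Complex.norm_real, Real.norm_eq_abs, abs_pow, abs_norm]
    exact pow_le_one₀ (norm_nonneg _) (norm_boxKernel_le_one Q M ξ)
  · rw [hsq]
    exact ((Complex.continuous_ofReal.comp (continuous_norm.pow 2)).tendsto _).comp
      (tendsto_boxKernel Q ξ)

/-- Real parts: the structure factor per site tends to `braggWeight μ ![Q]`. -/
theorem tendsto_boxPairMean_re_braggWeight
    (hμ : ∀ r : Fin d → ℤ, ∫ ξ, exp ((∑ i, (r i : ℝ) * ξ i : ℝ) * I) ∂μ = C r)
    (Q : Fin d → ℝ) :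
    Tendsto (fun M => (boxPairMean C Q M).re) atTop (𝓝 (braggWeight μ ![Q])) := by
  rw [braggWeight_single]
  have h := (Complex.continuous_re.tendsto _).comp (tendsto_boxPairMean μ hμ Q)
  rwa [Complex.ofReal_re] at h

end Wiener

end Summit.Ventures.CertifiedManyBodySolver.Observables

end
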